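import Literature.MathematicalPhysics.QuantumLattice.HubbardUVSymbolCTFrameDifferences
import Literature.Probability.LatticeModels.TorusAdditiveWeightSum
import HarnessLib

/-!
# The FRAME DEFECT of the one-shot covariance on the time grid, `Sᵀ(C^K_{>Λ} − C^{K′}_{>Λ})S`: row and column sums and entry sup, LINEAR in the
# band distance `(ε₀, ε₁, ε₂)` of the two frames, uniform in the Matsubara cutoff (up to the four time-edge points)

Topic `MathematicalPhysics/QuantumLattice`; the two-frame companion of `HubbardUVCovarianceCTDecayBound` (cell gate-hubbard-kl, crux K3: the covariance
data — `hrow`/`hcol`, entry sup `s` — of the near-identity step `GrassmannNearIdentityStep.sum_norm_kernel_effAction_sub_self_le_of_gramBounded` for the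
symbol-difference defect between the flow frames of two volumes, or two consecutive flow frames, at ONE scale `Λ`; its Gram constant is additive,
`GrassmannGramBoundedSum.IsGramBoundedR.sub`).  The difference of the pulled-back covariances is the pullback of the normal covariance of the
DIFFERENCE symbol (`gridSub_hubbardCovAboveCT_sub`, `normalCovariance_sub_symbol`), so the generic row/column-sum bound
`HubbardGridCharacters.sum_norm_gridSub_pullback_row_le/col_le` applies with the `ℓ¹` norm of its character sum, priced by the weighted Plancherel
inequality (`TorusFourierWeightedL1Prod.sum_sum_norm_prodChar_le`, additive quartic weight, `TorusAdditiveWeightSum.sum_inv_additiveWeight_le`) from the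
three `ℓ²` sums of `HubbardUVSymbolCTFrameDifferences`:

* `sum_sum_norm_charSum_gridSymbol_le_of_sq_sums` — GENERIC in the symbol `p`: the `ℓ¹` norm of the character sum from any three `ℓ²` bounds
  `T₀, T₁, T₂` (value, second time difference, second space differences), `≤ √((2+12/s₀)·14²)·√(N·L²·(T₀ + (N s₀/4)⁴T₁ + 2(L/4)⁴T₂))`;
* `sum_sum_norm_charSum_gridSymbol_sub_le` — the instance for `uvSymbolCT … K Λ − uvSymbolCT … K′ Λ`;
* `gridSub_hubbardCovAboveCT_sub`, **`rowSum_gridSub_hubbardCovAboveCT_sub_le`**, **`colSum_gridSub_hubbardCovAboveCT_sub_le`**;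
* `norm_charSum_le_sum_norm`, **`norm_gridSub_hubbardCovAboveCT_sub_apply_le`** — the entry sup `≤ L²·(βL²)⁻²·βL²·C_{0,1}ε₀·2β/Λ = 2C_{0,1}ε₀/Λ·(1/β)·β`
  (one envelope power more than the one-frame symbol, hence uniform in `M`).

Hypotheses: `0 < β`, `0 < Λ`, `2 ≤ M`, `2M ≤ N`, `UVLineBound μ K D`, `UVLineBound μ K′ D`, the spelled-out band-difference datum `hΔ` with bounds `ε₀, ε₁, ε₂` (`0 ≤ D, ε₀, ε₁`).
Everything is proved; no definitions; no named facts.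

## Sources

G. Benfatto, A. Giuliani, V. Mastropietro, Ann. Henri Poincaré 7 (2006) 809–898, §2.1 (2.3), §2.2 (2.23), Lemma 2.2, §2.8 (2.80)–(2.81), App. A1
(`BenfattoGiulianiMastropietro2006`); W. de Siqueira Pedra, M. Salmhofer, Comm. Math. Phys. 282 (2008) 797–818, §4 Cor. 4.4 (`PedraSalmhofer2008`).
The `[cite: …]` tags LOCATE the constructs; the statements are routine instances.
-/

noncomputable section

namespace Literature.MathematicalPhysics.QuantumLattice

open Literature.Probability.LatticeModels Finset Complex

variable {L M N : ℕ} [NeZero L] [NeZero N]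

/-! ### The `ℓ¹` norm of a character sum from three `ℓ²` bounds (generic in the symbol) -/

/-- **Weighted Plancherel with the additive quartic weight, generic symbol**: if the padded symbol `G = gridSymbol L M N β p σ` has
`Σ‖G‖² ≤ T₀`, `Σ‖(Δ_u)²G‖² ≤ T₁` (time) and `Σ‖(Δ_{e_l})²G‖² ≤ T₂` for both lattice directions, then for every `s₀ > 0`
`Σ_{(a,b)} ‖Σ_q χ_q(a,b) G(q)‖ ≤ √((2+12/s₀)·14²)·√(N·L²·(T₀ + (N s₀/4)⁴·T₁ + 2·(L/4)⁴·T₂))`. [cite: BenfattoGiulianiMastropietro2006, §2.8 (2.80)-(2.81)] -/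
theorem sum_sum_norm_charSum_gridSymbol_le_of_sq_sums (β : ℝ) (p : FreqMomentum L M × Fin 2 → ℂ) (σ : Fin 2) {T₀ T₁ T₂ : ℝ}
    (hT₀ : ∑ q₀ : TorusSite 1 N, ∑ qv : TorusSite 2 L, ‖gridSymbol L M N β p σ q₀ qv‖ ^ 2 ≤ T₀)
    (hT₁ : ∑ q₀ : TorusSite 1 N, ∑ qv : TorusSite 2 L,
      ‖(fwdDiff (fun _ : Fin 1 => (1 : ZMod N)))^[2] (fun q => gridSymbol L M N β p σ q qv) q₀‖ ^ 2 ≤ T₁)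
    (hT₂ : ∀ l : Fin 2, ∑ q₀ : TorusSite 1 N, ∑ qv : TorusSite 2 L,
      ‖(fwdDiff (Pi.single l (1 : ZMod L) : TorusSite 2 L))^[2] (gridSymbol L M N β p σ q₀) qv‖ ^ 2 ≤ T₂)
    {s₀ : ℝ} (hs₀ : 0 < s₀) :
    ∑ a : TorusSite 1 N, ∑ bv : TorusSite 2 L,
        ‖∑ q₀ : TorusSite 1 N, ∑ qv : TorusSite 2 L, torusChar q₀ a * torusChar qv bv * gridSymbol L M N β p σ q₀ qv‖ ≤
      Real.sqrt ((2 + 12 / s₀) * 14 ^ 2) *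
        Real.sqrt ((N : ℝ) ^ 1 * (L : ℝ) ^ 2 * (T₀ + ((N : ℝ) * s₀ / 4) ^ 4 * T₁ + 2 * (((L : ℝ) / 4) ^ 4 * T₂))) := by
  have hL : (0 : ℝ) < L := by exact_mod_cast Nat.pos_of_ne_zero (NeZero.ne L)
  have hNpos : (0 : ℝ) < N := by exact_mod_cast Nat.pos_of_ne_zero (NeZero.ne N)
  set G := gridSymbol L M N β p σ with hG
  set cT : ℝ := ((N : ℝ) * s₀ / 4) ^ 4 with hcT
  set cX : ℝ := ((L : ℝ) / 4) ^ 4 with hcX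
  have hP := sum_sum_norm_prodChar_le (d₁ := 1) (L₁ := N) (d₂ := 2) (L₂ := L) (univ : Finset (Fin 2))
    (fun _ : Fin 1 => (1 : ZMod N)) cT (by positivity) (fun l : Fin 2 => (Pi.single l (1 : ZMod L) : TorusSite 2 L))
    (fun _ => cX) (fun _ _ => by positivity) 2 G
  refine hP.trans (mul_le_mul ?_ ?_ (Real.sqrt_nonneg _) (Real.sqrt_nonneg _))
  · -- the weight sum
    refine Real.sqrt_le_sqrt ?_
    have hW := sum_inv_additiveWeight_le (N := N) (L := L) hs₀ (fun _ : Fin 2 => (1 : ℝ)) (fun _ => one_pos)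
    have hrw : ∀ (a : TorusSite 1 N) (b : TorusSite 2 L),
        (1 + cT * (4 * |((∑ j, (fun _ : Fin 1 => (1 : ZMod N)) j * a j).valMinAbs : ℝ)| / N) ^ (2 * 2) +
            ∑ i ∈ (univ : Finset (Fin 2)), cX * (4 * |((∑ j, (Pi.single i (1 : ZMod L) : TorusSite 2 L) j * b j).valMinAbs : ℝ)| / L) ^ (2 * 2))⁻¹ =
          (1 + (s₀ * |(((a 0).valMinAbs : ℤ) : ℝ)|) ^ 4 + ∑ i, ((fun _ : Fin 2 => (1 : ℝ)) i * |(((b i).valMinAbs : ℤ) : ℝ)|) ^ 4)⁻¹ := by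
      intro a b
      have h1 : (∑ j, (fun _ : Fin 1 => (1 : ZMod N)) j * a j) = a 0 := by simp
      have h2 : ∀ i : Fin 2, (∑ j, (Pi.single i (1 : ZMod L) : TorusSite 2 L) j * b j) = b i := by
        intro i; simp [Pi.single_apply]
      simp_rw [h1, h2]
      congr 1
      congr 1
      · congr 1
        rw [hcT, ← mul_pow]
        congr 1
        field_simp
      · refine sum_congr rfl fun i _ => ?_
        rw [hcX, ← mul_pow, one_mul]
        congr 1
        field_simp
    simp_rw [hrw]
    refine hW.trans (le_of_eq ?_)
    norm_num [Fin.prod_univ_two]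
  · -- the three ℓ² sums
    refine Real.sqrt_le_sqrt (mul_le_mul_of_nonneg_left ?_ (by positivity))
    refine add_le_add (add_le_add hT₀ (mul_le_mul_of_nonneg_left hT₁ (by positivity))) ?_
    rw [Fin.sum_univ_two, two_mul]
    exact add_le_add (mul_le_mul_of_nonneg_left (hT₂ 0) (by positivity)) (mul_le_mul_of_nonneg_left (hT₂ 1) (by positivity))

/-! ### The difference symbol of two frames -/

section TwoFrames

variable {β μ Λ : ℝ} {K K' : TrigPolyC4v} {D ε₀ ε₁ ε₂ : ℝ}

/-- **The `ℓ¹` norm of the character sum of the DIFFERENCE symbol** `uvSymbolCT … K Λ − uvSymbolCT … K′ Λ`: the generic bound with the three `ℓ²`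
sums of `HubbardUVSymbolCTFrameDifferences` (every term linear in `ε₀, ε₁, ε₂` squared). [cite: BenfattoGiulianiMastropietro2006, §2.8 (2.80)-(2.81)] -/
theorem sum_sum_norm_charSum_gridSymbol_sub_le (hβ : 0 < β) (hΛ : 0 < Λ) (hD : 0 ≤ D) (hε₀ : 0 ≤ ε₀) (hε₁ : 0 ≤ ε₁)
    (hline : UVLineBound μ K D) (hline' : UVLineBound μ K' D) (hΔ : ∀ (p : Fin 2 → ℝ) (l : Fin 2), ∃ d' d'' : ℝ → ℝ,
      (∀ t, HasDerivAt (fun t => K.eval (p + t • Pi.single l 1) - K'.eval (p + t • Pi.single l 1)) (d' t) t) ∧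
        (∀ t, HasDerivAt d' (d'' t) t) ∧
          ∀ t, |K.eval (p + t • Pi.single l 1) - K'.eval (p + t • Pi.single l 1)| ≤ ε₀ ∧ |d' t| ≤ ε₁ ∧ |d'' t| ≤ ε₂) (hM : 2 ≤ M) (hMN : 2 * M ≤ N)
    {s₀ : ℝ} (hs₀ : 0 < s₀) (σ : Fin 2) :
    ∑ a : TorusSite 1 N, ∑ bv : TorusSite 2 L,
        ‖∑ q₀ : TorusSite 1 N, ∑ qv : TorusSite 2 L, torusChar q₀ a * torusChar qv bv *
          gridSymbol L M N β (fun ks => uvSymbolCT L M β μ K Λ ks - uvSymbolCT L M β μ K' Λ ks) σ q₀ qv‖ ≤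
      Real.sqrt ((2 + 12 / s₀) * 14 ^ 2) *
        Real.sqrt ((N : ℝ) ^ 1 * (L : ℝ) ^ 2 *
          ((L : ℝ) ^ 2 * ((1 / (β * (L : ℝ) ^ 2)) ^ 4 * (β * (L : ℝ) ^ 2) ^ 2 * (uvMixedConst Λ 0 1 * ε₀) ^ 2 * ((2 / Λ) ^ (2 * 1) * (2 * β / Λ))) +
            ((N : ℝ) * s₀ / 4) ^ 4 *
              ((L : ℝ) ^ 2 * ((1 / (β * (L : ℝ) ^ 2)) ^ 4 * (β * (L : ℝ) ^ 2) ^ 2 * (2 * Real.pi / β) ^ 4 * (uvMixedConst Λ 2 1 * ε₀) ^ 2 *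
                  (4 ^ 4 * ((2 / Λ) ^ (2 * 4 - 2) * (2 * β / Λ)) + 4 * (2 : ℕ) * (2 / Λ) ^ (2 * 4))) +
                4 * ((L : ℝ) ^ 2 * (4 * ((1 / (β * (L : ℝ) ^ 2)) ^ 2 * ((β * (L : ℝ) ^ 2) *
                  (uvMixedConst Λ 0 1 * ε₀ * (β / (Real.pi * (2 * M - 3))) ^ 2)))) ^ 2)) +
            2 * (((L : ℝ) / 4) ^ 4 *
              ((L : ℝ) ^ 2 * ((1 / (β * (L : ℝ) ^ 2)) ^ 4 * (β * (L : ℝ) ^ 2) ^ 2 * (2 * Real.pi / L) ^ 4 *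
                (uvMixedConst Λ 0 3 * (2 / Λ) ^ 2 * D ^ 2 * ε₀ + uvMixedConst Λ 0 2 * (2 / Λ) * (D * ε₀ + 2 * D * ε₁) + uvMixedConst Λ 0 1 * ε₂) ^ 2 *
                  ((2 / Λ) ^ (2 * 1) * (2 * β / Λ))))))) := by
  have hε : ∀ k : TorusSite 2 L, |K.eval (latticeMomentum L k) - K'.eval (latticeMomentum L k)| ≤ ε₀ := fun k => abs_eval_sub_le_of_lineDiff hΔ _
  exact sum_sum_norm_charSum_gridSymbol_le_of_sq_sums β _ σ (sum_norm_sq_gridSymbol_sub_le hβ hΛ hε hMN σ)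
    (sum_norm_sq_fwdDiff_two_time_gridSymbol_sub_le hβ hΛ hε hM hMN σ)
    (fun l => sum_norm_sq_fwdDiff_two_space_gridSymbol_sub_le hβ hΛ hD hε₀ hε₁ hline hline' hΔ hMN σ l) hs₀

omit [NeZero N] in
/-- **The difference of the pulled-back one-shot covariances of two frames is the pullback of the normal covariance of the difference symbol.**
[cite: BenfattoGiulianiMastropietro2006, §2.2 (2.23)] -/
theorem gridSub_hubbardCovAboveCT_sub (β μ : ℝ) (K K' : TrigPolyC4v) (Λ : ℝ) :
    (hubbardGridSub L M β N).transpose * hubbardCovAboveCT L M β μ 0 K Λ * hubbardGridSub L M β N -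
        (hubbardGridSub L M β N).transpose * hubbardCovAboveCT L M β μ 0 K' Λ * hubbardGridSub L M β N =
      (hubbardGridSub L M β N).transpose *
          normalCovariance L M (fun ks => uvSymbolCT L M β μ K Λ ks - uvSymbolCT L M β μ K' Λ ks) * hubbardGridSub L M β N := by
  rw [hubbardCovAboveCT_zero_seed_eq_normalCovariance_uvSymbolCT, hubbardCovAboveCT_zero_seed_eq_normalCovariance_uvSymbolCT,
    normalCovariance_sub_symbol, Matrix.mul_sub, Matrix.sub_mul]

/-- **ROW SUMS OF THE FRAME DEFECT** (`hrow` of the near-identity step for `D = Sᵀ(C^K_{>Λ} − C^{K′}_{>Λ})S`): for every grid leg `X` and every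
`s₀ > 0`, `Σ_Y ‖D X Y‖ ≤ √((2+12/s₀)·14²)·√(N·L²·[the three ℓ²-terms of the difference symbol])` — linear in `(ε₀, ε₁, ε₂)`.
[cite: PedraSalmhofer2008, §4 Cor. 4.4] -/
theorem rowSum_gridSub_hubbardCovAboveCT_sub_le (hβ : 0 < β) (hΛ : 0 < Λ) (hD : 0 ≤ D) (hε₀ : 0 ≤ ε₀) (hε₁ : 0 ≤ ε₁)
    (hline : UVLineBound μ K D) (hline' : UVLineBound μ K' D) (hΔ : ∀ (p : Fin 2 → ℝ) (l : Fin 2), ∃ d' d'' : ℝ → ℝ,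
      (∀ t, HasDerivAt (fun t => K.eval (p + t • Pi.single l 1) - K'.eval (p + t • Pi.single l 1)) (d' t) t) ∧
        (∀ t, HasDerivAt d' (d'' t) t) ∧
          ∀ t, |K.eval (p + t • Pi.single l 1) - K'.eval (p + t • Pi.single l 1)| ≤ ε₀ ∧ |d' t| ≤ ε₁ ∧ |d'' t| ≤ ε₂) (hM : 2 ≤ M) (hMN : 2 * M ≤ N)
    {s₀ : ℝ} (hs₀ : 0 < s₀) (X : GridLeg (GridPoint L N)) :
    ∑ Y : GridLeg (GridPoint L N),
        ‖((hubbardGridSub L M β N).transpose * hubbardCovAboveCT L M β μ 0 K Λ * hubbardGridSub L M β N -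
            (hubbardGridSub L M β N).transpose * hubbardCovAboveCT L M β μ 0 K' Λ * hubbardGridSub L M β N) X Y‖ ≤
      Real.sqrt ((2 + 12 / s₀) * 14 ^ 2) *
        Real.sqrt ((N : ℝ) ^ 1 * (L : ℝ) ^ 2 *
          ((L : ℝ) ^ 2 * ((1 / (β * (L : ℝ) ^ 2)) ^ 4 * (β * (L : ℝ) ^ 2) ^ 2 * (uvMixedConst Λ 0 1 * ε₀) ^ 2 * ((2 / Λ) ^ (2 * 1) * (2 * β / Λ))) +
            ((N : ℝ) * s₀ / 4) ^ 4 *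
              ((L : ℝ) ^ 2 * ((1 / (β * (L : ℝ) ^ 2)) ^ 4 * (β * (L : ℝ) ^ 2) ^ 2 * (2 * Real.pi / β) ^ 4 * (uvMixedConst Λ 2 1 * ε₀) ^ 2 *
                  (4 ^ 4 * ((2 / Λ) ^ (2 * 4 - 2) * (2 * β / Λ)) + 4 * (2 : ℕ) * (2 / Λ) ^ (2 * 4))) +
                4 * ((L : ℝ) ^ 2 * (4 * ((1 / (β * (L : ℝ) ^ 2)) ^ 2 * ((β * (L : ℝ) ^ 2) *
                  (uvMixedConst Λ 0 1 * ε₀ * (β / (Real.pi * (2 * M - 3))) ^ 2)))) ^ 2)) +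
            2 * (((L : ℝ) / 4) ^ 4 *
              ((L : ℝ) ^ 2 * ((1 / (β * (L : ℝ) ^ 2)) ^ 4 * (β * (L : ℝ) ^ 2) ^ 2 * (2 * Real.pi / L) ^ 4 *
                (uvMixedConst Λ 0 3 * (2 / Λ) ^ 2 * D ^ 2 * ε₀ + uvMixedConst Λ 0 2 * (2 / Λ) * (D * ε₀ + 2 * D * ε₁) + uvMixedConst Λ 0 1 * ε₂) ^ 2 *
                  ((2 / Λ) ^ (2 * 1) * (2 * β / Λ))))))) := by
  rw [gridSub_hubbardCovAboveCT_sub]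
  exact sum_norm_gridSub_pullback_row_le hβ.ne' hMN _
    (fun σ => sum_sum_norm_charSum_gridSymbol_sub_le hβ hΛ hD hε₀ hε₁ hline hline' hΔ hM hMN hs₀ σ) X

/-- **COLUMN SUMS OF THE FRAME DEFECT** (`hcol`): the same bound for `Σ_X ‖D X Y‖`. [cite: PedraSalmhofer2008, §4 Cor. 4.4] -/
theorem colSum_gridSub_hubbardCovAboveCT_sub_le (hβ : 0 < β) (hΛ : 0 < Λ) (hD : 0 ≤ D) (hε₀ : 0 ≤ ε₀) (hε₁ : 0 ≤ ε₁)
    (hline : UVLineBound μ K D) (hline' : UVLineBound μ K' D) (hΔ : ∀ (p : Fin 2 → ℝ) (l : Fin 2), ∃ d' d'' : ℝ → ℝ,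
      (∀ t, HasDerivAt (fun t => K.eval (p + t • Pi.single l 1) - K'.eval (p + t • Pi.single l 1)) (d' t) t) ∧
        (∀ t, HasDerivAt d' (d'' t) t) ∧
          ∀ t, |K.eval (p + t • Pi.single l 1) - K'.eval (p + t • Pi.single l 1)| ≤ ε₀ ∧ |d' t| ≤ ε₁ ∧ |d'' t| ≤ ε₂) (hM : 2 ≤ M) (hMN : 2 * M ≤ N)
    {s₀ : ℝ} (hs₀ : 0 < s₀) (Y : GridLeg (GridPoint L N)) :
    ∑ X : GridLeg (GridPoint L N),
        ‖((hubbardGridSub L M β N).transpose * hubbardCovAboveCT L M β μ 0 K Λ * hubbardGridSub L M β N -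
            (hubbardGridSub L M β N).transpose * hubbardCovAboveCT L M β μ 0 K' Λ * hubbardGridSub L M β N) X Y‖ ≤
      Real.sqrt ((2 + 12 / s₀) * 14 ^ 2) *
        Real.sqrt ((N : ℝ) ^ 1 * (L : ℝ) ^ 2 *
          ((L : ℝ) ^ 2 * ((1 / (β * (L : ℝ) ^ 2)) ^ 4 * (β * (L : ℝ) ^ 2) ^ 2 * (uvMixedConst Λ 0 1 * ε₀) ^ 2 * ((2 / Λ) ^ (2 * 1) * (2 * β / Λ))) +
            ((N : ℝ) * s₀ / 4) ^ 4 *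
              ((L : ℝ) ^ 2 * ((1 / (β * (L : ℝ) ^ 2)) ^ 4 * (β * (L : ℝ) ^ 2) ^ 2 * (2 * Real.pi / β) ^ 4 * (uvMixedConst Λ 2 1 * ε₀) ^ 2 *
                  (4 ^ 4 * ((2 / Λ) ^ (2 * 4 - 2) * (2 * β / Λ)) + 4 * (2 : ℕ) * (2 / Λ) ^ (2 * 4))) +
                4 * ((L : ℝ) ^ 2 * (4 * ((1 / (β * (L : ℝ) ^ 2)) ^ 2 * ((β * (L : ℝ) ^ 2) *
                  (uvMixedConst Λ 0 1 * ε₀ * (β / (Real.pi * (2 * M - 3))) ^ 2)))) ^ 2)) +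
            2 * (((L : ℝ) / 4) ^ 4 *
              ((L : ℝ) ^ 2 * ((1 / (β * (L : ℝ) ^ 2)) ^ 4 * (β * (L : ℝ) ^ 2) ^ 2 * (2 * Real.pi / L) ^ 4 *
                (uvMixedConst Λ 0 3 * (2 / Λ) ^ 2 * D ^ 2 * ε₀ + uvMixedConst Λ 0 2 * (2 / Λ) * (D * ε₀ + 2 * D * ε₁) + uvMixedConst Λ 0 1 * ε₂) ^ 2 *
                  ((2 / Λ) ^ (2 * 1) * (2 * β / Λ))))))) := by
  rw [gridSub_hubbardCovAboveCT_sub]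
  exact sum_norm_gridSub_pullback_col_le hβ.ne' hMN _
    (fun σ => sum_sum_norm_charSum_gridSymbol_sub_le hβ hΛ hD hε₀ hε₁ hline hline' hΔ hM hMN hs₀ σ) Y

/-! ### The entry sup of the frame defect -/

/-- A character sum is bounded by the `ℓ¹` norm of its coefficients (`|χ| = 1`). [cite: BenfattoGiulianiMastropietro2006, §2.1 (2.3)] -/
theorem norm_charSum_le_sum_norm (G : TorusSite 1 N → TorusSite 2 L → ℂ) (a : TorusSite 1 N) (b : TorusSite 2 L) :
    ‖∑ q₀ : TorusSite 1 N, ∑ qv : TorusSite 2 L, torusChar q₀ a * torusChar qv b * G q₀ qv‖ ≤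
      ∑ q₀ : TorusSite 1 N, ∑ qv : TorusSite 2 L, ‖G q₀ qv‖ := by
  refine (norm_sum_le _ _).trans (sum_le_sum fun q₀ _ => (norm_sum_le _ _).trans (sum_le_sum fun qv _ => ?_))
  rw [norm_mul, norm_mul, norm_torusChar, norm_torusChar, one_mul, one_mul]

/-- **The `ℓ¹` norm over the dual torus of the difference symbol** (the entry scale): `Σ_q ‖(G_K − G_{K′})(q)‖ ≤ L²·(βL²)⁻²·βL²·C_{0,1}ε₀·2β/Λ`
(`2M ≤ N`; one envelope power more than the one-frame symbol, hence uniform in `M`). [cite: BenfattoGiulianiMastropietro2006, §2.1 (2.3)] -/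
theorem sum_norm_gridSymbol_sub_le (hβ : 0 < β) (hΛ : 0 < Λ)
    (hε₀ : ∀ k : TorusSite 2 L, |K.eval (latticeMomentum L k) - K'.eval (latticeMomentum L k)| ≤ ε₀) (hMN : 2 * M ≤ N) (σ : Fin 2) :
    ∑ q₀ : TorusSite 1 N, ∑ qv : TorusSite 2 L, ‖gridSymbol L M N β (fun ks => uvSymbolCT L M β μ K Λ ks - uvSymbolCT L M β μ K' Λ ks) σ q₀ qv‖ ≤
      (L : ℝ) ^ 2 * ((1 / (β * (L : ℝ) ^ 2)) ^ 2 * (β * (L : ℝ) ^ 2) * (uvMixedConst Λ 0 1 * ε₀) * ((2 / Λ) ^ (2 * 0) * (2 * β / Λ))) := by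
  set c := β * (L : ℝ) ^ 2 with hc
  set A := uvMixedConst Λ 0 1 * ε₀ with hA
  have hpt : ∀ (q₀ : TorusSite 1 N) (qv : TorusSite 2 L),
      ‖gridSymbol L M N β (fun ks => uvSymbolCT L M β μ K Λ ks - uvSymbolCT L M β μ K' Λ ks) σ q₀ qv‖ ≤
        if (q₀ 0).val < 2 * M then (1 / c) ^ 2 * c * A * (1 / max |gridFreq M N β q₀| (Λ / 2) ^ (2 * 0 + 2)) else 0 := by
    intro q₀ qv
    split_ifs with hq
    · have h := norm_gridSymbol_sub_le (μ := μ) (Λ := Λ) (M := M) (N := N) hβ hΛ hε₀ σ q₀ qv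
      have hm := uvEnv_pos hΛ (gridFreq M N β q₀)
      refine h.trans (le_of_eq ?_)
      rw [← hc, ← hA]
      field_simp
    · rw [gridSymbol_uvSymbolCT_sub_eq hβ, if_neg hq, norm_zero]
  refine (sum_le_sum fun q₀ _ => sum_le_sum fun qv _ => hpt q₀ qv).trans ?_
  rw [sum_sum_window_eq hMN β (fun ω => (1 / c) ^ 2 * c * A * (1 / max |ω| (Λ / 2) ^ (2 * 0 + 2))), ← mul_sum]
  have hA0 : 0 ≤ A := by
    have := uvMixedConst_nonneg Λ 0 1
    have hε : 0 ≤ ε₀ := (abs_nonneg _).trans (hε₀ 0)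
    positivity
  exact mul_le_mul_of_nonneg_left (mul_le_mul_of_nonneg_left (sum_inv_uvEnv_pow_le hβ hΛ M 0) (by positivity)) (by positivity)

/-- **THE ENTRY SUP OF THE FRAME DEFECT** (the slot `s` of the near-identity step): for all grid legs `X, Y`,
`‖(Sᵀ(C^K_{>Λ} − C^{K′}_{>Λ})S) X Y‖ ≤ L²·(βL²)⁻²·βL²·C_{0,1}ε₀·2β/Λ` (`= 2C_{0,1}ε₀/Λ` after cancellation; equal charges and different spins give
`0`, the `(−,+)` entry is minus a `(+,−)` entry). [cite: BenfattoGiulianiMastropietro2006, §2.1 (2.3)] -/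
theorem norm_gridSub_hubbardCovAboveCT_sub_apply_le (hβ : 0 < β) (hΛ : 0 < Λ)
    (hε₀ : ∀ k : TorusSite 2 L, |K.eval (latticeMomentum L k) - K'.eval (latticeMomentum L k)| ≤ ε₀) (hMN : 2 * M ≤ N)
    (X Y : GridLeg (GridPoint L N)) :
    ‖((hubbardGridSub L M β N).transpose * hubbardCovAboveCT L M β μ 0 K Λ * hubbardGridSub L M β N -
        (hubbardGridSub L M β N).transpose * hubbardCovAboveCT L M β μ 0 K' Λ * hubbardGridSub L M β N) X Y‖ ≤
      (L : ℝ) ^ 2 * ((1 / (β * (L : ℝ) ^ 2)) ^ 2 * (β * (L : ℝ) ^ 2) * (uvMixedConst Λ 0 1 * ε₀) * ((2 / Λ) ^ (2 * 0) * (2 * β / Λ))) := by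
  rw [gridSub_hubbardCovAboveCT_sub]
  set p : FreqMomentum L M × Fin 2 → ℂ := fun ks => uvSymbolCT L M β μ K Λ ks - uvSymbolCT L M β μ K' Λ ks with hp
  set C' := (hubbardGridSub L M β N).transpose * normalCovariance L M p * hubbardGridSub L M β N with hC'
  have hB0 : 0 ≤ (L : ℝ) ^ 2 * ((1 / (β * (L : ℝ) ^ 2)) ^ 2 * (β * (L : ℝ) ^ 2) * (uvMixedConst Λ 0 1 * ε₀) * ((2 / Λ) ^ (2 * 0) * (2 * β / Λ))) := by
    have := uvMixedConst_nonneg Λ 0 1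
    have hε : 0 ≤ ε₀ := (abs_nonneg _).trans (hε₀ 0)
    positivity
  -- the `(+,−)` entries
  have h01 : ∀ (j j' : Fin N) (x x' : TorusSite 2 L) (σ : Fin 2), ‖C' (((j, x), σ), 0) (((j', x'), σ), 1)‖ ≤
      (L : ℝ) ^ 2 * ((1 / (β * (L : ℝ) ^ 2)) ^ 2 * (β * (L : ℝ) ^ 2) * (uvMixedConst Λ 0 1 * ε₀) * ((2 / Λ) ^ (2 * 0) * (2 * β / Λ))) := by
    intro j j' x x' σ
    rw [hC', norm_gridSub_pullback_apply_zero_one_eq hβ.ne' hMN p j j' x x' σ]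
    exact (norm_charSum_le_sum_norm _ _ _).trans (sum_norm_gridSymbol_sub_le hβ hΛ hε₀ hMN σ)
  have hC'def : C' = (gridSubMatrix L M β (fun q : GridPoint L N => q.2) (fun q => gridTime β N q.1)).transpose * normalCovariance L M p *
      gridSubMatrix L M β (fun q : GridPoint L N => q.2) (fun q => gridTime β N q.1) := by rw [hC', hubbardGridSub]
  obtain ⟨⟨⟨j, x⟩, σ⟩, c⟩ := X
  obtain ⟨⟨⟨j', x'⟩, σ'⟩, c'⟩ := Y
  by_cases hc : c = c'
  · rw [hC'def, gridSub_pullback_normalCovariance_apply_of_charge_eq β _ _ p (Y := (((j, x), σ), c)) (Y' := (((j', x'), σ'), c')) hc, norm_zero]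
    exact hB0
  by_cases hs : σ = σ'
  · subst hs
    have hc2 : (c = 0 ∧ c' = 1) ∨ (c = 1 ∧ c' = 0) := by
      fin_cases c <;> fin_cases c' <;> simp_all
    rcases hc2 with ⟨rfl, rfl⟩ | ⟨rfl, rfl⟩
    · exact h01 j j' x x' σ
    · have h10 := gridSub_pullback_normalCovariance_apply_one_zero β (fun q : GridPoint L N => q.2) (fun q => gridTime β N q.1) p
        (j, x) (j', x') σ σ
      rw [hC'def, h10, norm_neg, ← hC'def]
      exact h01 j' j x' x σ
  · rw [hC'def, gridSub_pullback_normalCovariance_apply_of_spin_ne β _ _ p (Y := (((j, x), σ), c)) (Y' := (((j', x'), σ'), c')) hs, norm_zero]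
    exact hB0

end TwoFrames

end Literature.MathematicalPhysics.QuantumLattice

end
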